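import Summits.SmoothPoincare4.SmoothPoincare4.Theses.WeakReductionDescent
import Literature.Barriers.SmoothPoincare4.WeaklyReducibleGenusThreeStandard
import Literature.Topology.FourManifolds.HomotopyS4CompactProofs
import Literature.Topology.FourManifolds.HomotopyS4OrientableProofs
import Literature.Barriers.SmoothPoincare4.LowGenusTrisectionsStandardProofs

/-!
# SmoothPoincare4 / WeakReductionDescent — `GenusThreeBase` is exactly the vendored Aranda–Zupan fact

Item stmt-SmoothPoincare4-17910 (`GenusThreeBase`, support, rank 9 of route WeakReductionDescent):
a smooth homotopy 4-sphere `M` (the Statement's bare binders: Hausdorff, second countable, `C^∞`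
atlas on `ℝ⁴`, `e : M ≃ₕ S⁴`) carrying a WEAKLY REDUCIBLE genus-`3` Gay–Kirby trisection
(`Literature.Topology.FourManifolds.IsGKTrisection M 3 k T` + the route's inline weak-reducibility
block) is diffeomorphic to `S⁴`.

Mathematically this is the homotopy-sphere corollary of Aranda–Zupan 2025, Theorem 1.3
(arXiv:2503.04607, p. 2: a closed 4-manifold with a weakly reducible genus-three trisection is
`S_p`, `S'_p`, `S⁴` or a connected sum of `±ℂP²`, `S¹ × S³`, `S² × S²`; the only homotopy sphere
in the list is `S⁴`), which the tree carries as the UNPROVED named fact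
`Literature.Barriers.SmoothPoincare4.az2025_weaklyReducible_genusThree_homotopySphere_gk`
(same inline clauses, stated for closed connected oriented `X` plus `X ≃ₕ S⁴`).

This file records, kernel-checked, that the item and the fact are the SAME statement:

* `genusThreeBase_of_az2025` — the fact (universe `0`) implies `GenusThreeBase`: a bare `M ≃ₕ S⁴`
  is compact (`compactSpace_of_homotopyEquiv_sphere_four_holds`, Hatcher Prop. 3.29), simply
  connected hence connected (`simplyConnectedSpace_sphere_four_holds` transported along `e`) and
  smoothly orientable (`isOrientable_of_homotopyEquiv_sphere_four_holds`, Lee Thm. 15.43) — all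
  three PROVED tree theorems — so the fact applies verbatim. CONDITIONAL on the fact (D-0014).
* `az2025_of_genusThreeBase` — conversely `GenusThreeBase` gives the fact back at universe `0`
  (drop the extra instance hypotheses).
* `genusThreeBase_iff_az2025` — hence `GenusThreeBase ↔ az2025_…_gk.{0}`: closing the item
  unconditionally is exactly a formal proof of AZ25 Thm 1.3 (homotopy-sphere corollary) over
  `IsGKTrisection`; nothing weaker suffices and nothing in the item is idle.
* `genusThreeBase_of_msz_of_balanced` — GIVEN the MSZ fact (`msz_homotopySphere_gk`, already the
  debt of `LowGenusBase`), the item reduces to its balanced case `k = (1,1,1)`: an exotic genus-`3`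
  trisected homotopy sphere is of type `(3;1,1,1)` (`eq_one_of_exotic_of_genus_three_of_msz_alone`,
  proved in tree from MSZ + the proved Euler identity). So the rung-`3` debt of the route is
  MSZ + AZ25 Thm 1.3 for weakly reducible `(3;1,1,1)`-trisections.
* Shield (not restated here): with the iff, the fact file's PROVED
  `az2025_weaklyReducible_genusThree_homotopySphere_gk_of_smoothPoincare` shows the item is
  implied by the smooth Poincaré conjecture itself — it cannot be refuted short of an exotic `S⁴`
  carrying a weakly reducible genus-`3` trisection.

What is NOT here: a proof of the fact (AZ25's 27-page argument: thin position for the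
`(3;1,1,1)` weak-reduction, waves, five-chains, Heegaard triples, and the Meier–Zupan genus-two
classification — none of it is in Mathlib or the tree).
-/

namespace Summit.SmoothPoincare4.SmoothPoincare4.Theorems

open scoped Manifold ContDiff ContinuousMap
open Summit.SmoothPoincare4.SmoothPoincare4.Theses.WeakReductionDescent

/-- **`GenusThreeBase` from the Aranda–Zupan fact** (conditional result, D-0014). Given the named
fact `Literature.Barriers.SmoothPoincare4.az2025_weaklyReducible_genusThree_homotopySphere_gk`
(AZ25 Thm 1.3, homotopy-sphere corollary, universe `0`), every smooth homotopy 4-sphere over the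
Statement's bare binders with a weakly reducible genus-`3` GK-trisection is diffeomorphic to `S⁴`.
Proof: `M` is compact (Hatcher Prop. 3.29, `compactSpace_of_homotopyEquiv_sphere_four_holds`),
simply connected (from `S⁴` along `e`) hence connected, and orientable (Lee Thm. 15.43,
`isOrientable_of_homotopyEquiv_sphere_four_holds`); apply the fact with these instances and the
chosen orientation. [cite: ArandaZupan2025, Thm. 1.3 (p. 2) and §2 (p. 6)] -/
theorem genusThreeBase_of_az2025
    (hAZ : Literature.Barriers.SmoothPoincare4.az2025_weaklyReducible_genusThree_homotopySphere_gk.{0}) :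
    GenusThreeBase := by
  unfold GenusThreeBase
  intro M _ _ _ _ _ e k T hT hwr
  haveI : CompactSpace M :=
    Literature.Topology.FourManifolds.compactSpace_of_homotopyEquiv_sphere_four_holds M e
  haveI : SimplyConnectedSpace (Metric.sphere (0 : EuclideanSpace ℝ (Fin 5)) 1) :=
    Literature.Topology.FourManifolds.simplyConnectedSpace_sphere_four_holds
  haveI : SimplyConnectedSpace M := e.simplyConnectedSpace
  obtain ⟨o⟩ :=
    Literature.Topology.FourManifolds.isOrientable_of_homotopyEquiv_sphere_four_holds M e
  exact hAZ M o k T hT hwr e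

/-- **The Aranda–Zupan fact (universe `0`) from `GenusThreeBase`**: the route item already covers
every closed connected oriented `X ≃ₕ S⁴` with a weakly reducible genus-`3` GK-trisection (the
extra `CompactSpace`/`ConnectedSpace`/orientation hypotheses of the fact are simply dropped).
[cite: ArandaZupan2025, Thm. 1.3 (p. 2)] -/
theorem az2025_of_genusThreeBase (h : GenusThreeBase) :
    Literature.Barriers.SmoothPoincare4.az2025_weaklyReducible_genusThree_homotopySphere_gk.{0} := by
  intro X _ _ _ _ _ _ _ _o k S hT hwr e
  exact h X e k S hT hwr

/-- **`GenusThreeBase` is exactly the vendored Aranda–Zupan fact at universe `0`.** Consequently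
an unconditional proof of item stmt-SmoothPoincare4-17910 is the same thing as discharging
`az2025_weaklyReducible_genusThree_homotopySphere_gk` (AZ25 Thm 1.3, homotopy-sphere corollary,
over `IsGKTrisection`). [cite: ArandaZupan2025, Thm. 1.3 (p. 2)] -/
theorem genusThreeBase_iff_az2025 :
    GenusThreeBase ↔
      Literature.Barriers.SmoothPoincare4.az2025_weaklyReducible_genusThree_homotopySphere_gk.{0} :=
  ⟨az2025_of_genusThreeBase, genusThreeBase_of_az2025⟩

/-- **Modulo MSZ, only the balanced type `(3; 1,1,1)` carries content.** GIVEN the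
Meier–Schirmer–Zupan fact `Literature.Barriers.SmoothPoincare4.msz_homotopySphere_gk` (the debt
the route already owes for `LowGenusBase`), `GenusThreeBase` follows from its restriction `hbal`
to trisections of type `(3; 1,1,1)` (`k = fun _ => 1`, same inline weak-reducibility block):
if a genus-`3` GK-trisected smooth homotopy 4-sphere `M` were not diffeomorphic to `S⁴`, then by
the PROVED tree theorem `eq_one_of_exotic_of_genus_three_of_msz_alone` (MSZ + the proved Euler
characteristic identity `g = k₀ + k₁ + k₂`) every `kᵢ = 1`, and `hbal` applies. So the route's
named-fact debt at rung `g = 3` is `msz_homotopySphere_gk` plus Aranda–Zupan Thm 1.3 for WEAKLY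
REDUCIBLE `(3; 1,1,1)`-trisections of homotopy spheres only.
[cite: ArandaZupan2025, Thm. 1.3 (p. 2)] [cite: MeierSchirmerZupan2016, Thm. 1.2 and Remark 3.12] -/
theorem genusThreeBase_of_msz_of_balanced
    (hMSZ : Literature.Barriers.SmoothPoincare4.msz_homotopySphere_gk.{0})
    (hbal : ∀ (M : Type) [TopologicalSpace M] [T2Space M] [SecondCountableTopology M]
      [ChartedSpace (EuclideanSpace ℝ (Fin 4)) M] [IsManifold (𝓡 4) ((⊤ : ℕ∞) : WithTop ℕ∞) M],
      (M ≃ₕ (Metric.sphere (0 : EuclideanSpace ℝ (Fin 5)) 1)) → ∀ (T : Fin 3 → Set M),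
      Literature.Topology.FourManifolds.IsGKTrisection M 3 (fun _ => 1) T →
      (let F : Set M := ⋂ l, T l
       let H : Fin 3 → Set M := fun p => ⋂ (l : Fin 3) (_ : l ≠ p), T l
       let IsCurve : Set M → Prop := fun c => c ⊆ F ∧
         ∃ γ : (Metric.sphere (0 : EuclideanSpace ℝ (Fin 2)) 1) → M,
           Manifold.IsSmoothEmbedding (𝓡 1) (𝓡 4) ((⊤ : ℕ∞) : WithTop ℕ∞) γ ∧ Set.range γ = c
       let BoundsDisc : Set M → Set M → Prop := fun A c =>
         ∃ d : (Metric.closedBall (0 : EuclideanSpace ℝ (Fin 2)) 1) → M,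
           Manifold.IsSmoothEmbedding (𝓡∂ 2) (𝓡 4) ((⊤ : ℕ∞) : WithTop ℕ∞) d ∧ Set.range d ⊆ A ∧
           d '' ((𝓡∂ 2).boundary (Metric.closedBall (0 : EuclideanSpace ℝ (Fin 2)) 1)) = c ∧
           Set.range d ∩ F = c
       let NonSep : Set M → Prop := fun c => IsConnected (F \ c)
       ∃ (p : Fin 3) (c c' : Set M), IsCurve c ∧ IsCurve c' ∧ Disjoint c c' ∧ NonSep c ∧
         NonSep c' ∧ BoundsDisc (H p) c ∧ ∀ q : Fin 3, q ≠ p → BoundsDisc (H q) c') →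
      Nonempty (Diffeomorph (𝓡 4) (𝓡 4) M (Metric.sphere (0 : EuclideanSpace ℝ (Fin 5)) 1)
        ((⊤ : ℕ∞) : WithTop ℕ∞))) :
    GenusThreeBase := by
  unfold GenusThreeBase
  intro M _ _ _ _ _ e k T hT hwr
  by_contra hE
  haveI hE' : IsEmpty (Diffeomorph (𝓡 4) (𝓡 4) M (Metric.sphere (0 : EuclideanSpace ℝ (Fin 5)) 1)
      ((⊤ : ℕ∞) : WithTop ℕ∞)) := not_nonempty_iff.mp hE
  haveI : CompactSpace M :=
    Literature.Topology.FourManifolds.compactSpace_of_homotopyEquiv_sphere_four_holds M e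
  haveI : SimplyConnectedSpace (Metric.sphere (0 : EuclideanSpace ℝ (Fin 5)) 1) :=
    Literature.Topology.FourManifolds.simplyConnectedSpace_sphere_four_holds
  haveI : SimplyConnectedSpace M := e.simplyConnectedSpace
  obtain ⟨o⟩ :=
    Literature.Topology.FourManifolds.isOrientable_of_homotopyEquiv_sphere_four_holds M e
  have hk : k = fun _ => 1 := funext fun i =>
    Literature.Barriers.SmoothPoincare4.eq_one_of_exotic_of_genus_three_of_msz_alone
      hMSZ M o hT e hE' i
  subst hk
  exact hE (hbal M e T hT hwr)

end Summit.SmoothPoincare4.SmoothPoincare4.Theorems
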